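/-
Copyright (c) 2026 the pub-hodgecm-mathlib formalisation cell (harness21).  Prover seat hodgecm-mathlib-K2E4-p23 (g3), Track B ∕ K2-LIT, h413 =
`stmt-HodgeConjecture-24833`, ENGINE E1, 5Res campaign «ENDGAME BY FAMILIES», RUNG 1, deal (273)(iii) plan (P2): the SELF-DUAL per-block package of the RUNG-1 socket
(★ p861518 §2 = ★ p861000 §3 over `quasiSplit`) at the maximal level — FILE C, the HEAD `selfDual_block_package` (the mirror of ★ p861419 `offDual_block_package`).
-/
import Summits.HodgeConjecture.HodgeConjecture.Theorems.K2E1ResidualBlockPackageSelfDualFamilyCMTwo      -- ★ p861599 (this seat): FILE B (rank one, block identification, `hMne`, SD intertwining) ⇒ ★ OD files 1c∕1b∕1a∕0, ★ p861360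
import Summits.HodgeConjecture.HodgeConjecture.Theorems.K2E1PseudoEisensteinFamilyDecompositionU2        -- ★ (K2E1-p12): `pureTensor_arithmeticBorel_mul`
import Summits.HodgeConjecture.HodgeConjecture.Theorems.K2E1EisensteinNiceClassCMTwo                      -- ★ F3d-δ (K2E1-p15): `memLp_quotFun_eisensteinSeriesU_of_nice`
import Summits.HodgeConjecture.HodgeConjecture.Theorems.K2E1ChiSectionArchConstantSelfDualCMTwo          -- ★ p861808 (K2E4-p14): `hVinf_maximalLevel_of_selfDual_cm` (the M1 datum `φ ∘ ι_∞ = φ(1)` for self-dual `χ`)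
import Literature.NumberTheory.Automorphic.UnitaryGroupBorelHeightContinuous                             -- ★ `continuous_borelHeight`
import HarnessLib

/-!
# K2·E1 — `K2E1ResidualBlockPackageSelfDualM1CMTwo`: THE SELF-DUAL PER-BLOCK PACKAGE OF THE RUNG-1 SOCKET AT THE MAXIMAL LEVEL (FILE C = the HEAD, RUNG 1 of the 5Res ladder)

Track B ∕ K2-LIT, crux h413 = `stmt-HodgeConjecture-24833`, route of record `HCCMUnconditional`; cell `hodgecm-mathlib`, squad K2, ENGINE E1.  Prover seat `hodgecm-mathlib-K2E4-p23` (g3);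
deal (273)(iii) plan (P2) (HANDOFF g2 → g3), A4 §3.  THEOREMS ONLY (no `def`, no `instance`, no notation, no named-fact hypothesis, no `sorry`); lane `--supports
stmt-HodgeConjecture-24833 --as helper` (count-neutral).  CLOSES NO SOCKET.  Frame: `G = U(J₂) = quasiSplit L⁺ L c 2`, `K_∞ = G(L⁺ ⊗ ℝ) ∩ U(1 ⊗ 1)`, `K = K_∞·GL₂(𝒪̂_L)` (M1: `K_c = K`).

THE MATHEMATICS ([MoeglinWaldspurger1995, II.2.4, IV.1.10, IV.3.12, VI.2]; [ReedSimonI1980, Thm. I.7, II.3]; [Langlands1976, §7]).  ★ p861518 §2 reduces RUNG 1 («`(L²_res)^{K_∞·K′_f}` is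
finite-dimensional») to per-block data `(gen, A, Ω, m, E, V, hV, Jb, h, hhl, hhr, s, hs, hU, hline)` for two families, consumed by the FINAL ★ p861721 `rung1_of_block_packages` as ONE
existential statement per block (`∃ A … Ω m E V Jb h s hs, hhl ∧ hhr ∧ hU ∧ hline ∧ hV`, atoms `FiniteDimensional ℂ A`) — the binder `hSD` of ★ `residual_invariants_finiteDimensional_maximalLevel_cm_final`;
the OFF-DUAL family is ★ p861419.  For a SELF-DUAL unitary Hecke character `χ` (`χʷ = χ`, trivial on `ℝ_{>0}` — finitely many blocks, ★ p861076) with `V(χ, K, 1) ≠ ⊥` whose sections are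
continuous (`hVc`, ★ p861779 at M1) this file delivers that existential with the witnesses `(A, Ω, m, E, Jb) := (⊕_{c ∈ S} W, ℝ, vol|_{(0,∞)}, W, Unit)`, `W = ℂ·φ|_K ≤ L²(K)` (rank one,
FILE B §1), `S` = the finitely many real poles of the M1 scattering scalar in `(½, 1]`: **`V`** `= WithLp.linearEquiv ∘ U_iso ∘ P_Θ` for the letter-free rank-one self-dual Plancherel
isometry ★ p861360 `U_iso : Θ ≅ (⊕_c W) ⊕₂ L²((0,∞); W)` on the `C²_c`-profile family (FILE B §1 identifies `Θ` with the C7″ block; its archimedean letter `φ ∘ ι_∞ = φ(1)` is ★ p861808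
for self-dual `χ`), **`h = a♮` SPHERICAL** and the Hecke operator `T = R_∞(a♮) ∘L R_f(e)` of ★ FILE 1a `exists_offDual_hecke_on_fix` (uniform in `χ`: gauge self-convolution `η` with an
ENTIRE NON-CONSTANT symbol `ŝ`, `T v = P_1 R(η) v` on `V_P`), **`s = ŝ(½ + i·)`** (`hs` from FILE B), **`hU` on `V_P`** (`P_G P_1 = P_G` ★ FILE 1a; FILE B §3 `U R(η) = (diag ŝ(c) ⊕
M_{ŝ(½+i·)}) U` on ALL of `L²` — only the CONTINUOUS coordinate is read), **`hline`** (★ p860608 on `(0,∞)`), **`hV`** (the isometry `U_iso` is injective on `Θ ⊇ G`).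
The structural measures are INHABITED INSIDE the proof exactly as in ★ p861419: `ν_G = (ν_∞ ⊗ ν_f)_*` (a Haar measure, ★ `adelicProdEquiv`), the idelic data (★ `exists_isIdeleClassDomain`,
Haar on `𝔸_Lˣ`), the radical data `(ν, 𝓕)` with `ν 𝓕 = 1` (★ `exists_unipotent_binders_cm_two`, right-invariance ★ `isMulRightInvariant_of_isMulLeftInvariant_two`), the covering weight and
the unfolded measure of `ν_G` (★ `exists_coveringWeight_unfoldedMeasure`).
* §1 `memLp_brick` (the `L²` class of `θ_{f,φ}`, ★ F3d-δ), `eq_zero_of_apply_one_eq_zero`, `hline_axis`.  * §2 `package_of_modelMap`: the PACKAGING LEMMA (model side abstract in `W`,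
  Hilbert side `L²` of any measure) producing the ∃-package from the isometry, `G = Θ`, `P_G P₁ = P_G`, `T v = P₁ (R v)` and the model intertwining — ONE instance context, so that the package's
  witnesses and clauses share their instance paths.  * §3 HEAD **`selfDual_block_package`** (all binders explicit, see §3's note).
BINDERS LEFT VISIBLE (all structural, every one fed BY NAME in the FINAL's frame; none asks an adelic subgroup to be open): ★ p861419's level∕projector binders VERBATIM (`νinf νf μK χ₁ e K′_f
hK'o he0 he1 heK P hPdef U₀ hU₀o hU₀c hK'U₀ hU₀Kc` at `K_c := K`, ★ `m1_level_witness`), the model Haar measure `μKU` of `K`, `χ` unitary (★ `HeckeCharacter.isUnitary_of_map_posRealIdele`) ∕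
ray-trivial ∕ self-dual with `V(χ, K, 1) ≠ ⊥`, the section letter `hVc` (continuity, ★ p861779), and `gen` with `hgen` (C7″'s generator bytes, `rfl` in the FINAL).
HONEST LABEL: HC_CM is proved only modulo the 7 printed citations (2 remaining named inputs: hLiu418 = `stmt-HodgeConjecture-24832`, h413 = `stmt-HodgeConjecture-24833`) until rung 0
closes; this file asserts no named fact and closes no socket; count-neutral; RUNG 1 (mod the FINAL's binder-free edition) ≠ 5Res.

## References
* [MoeglinWaldspurger1995] C. Mœglin, J.-L. Waldspurger, *Spectral decomposition and Eisenstein series* (1995), II.1.2, II.2.4, IV.1.10, IV.3.12, VI.2.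
* [ReedSimonI1980] M. Reed, B. Simon, *Methods of Modern Mathematical Physics I* (1980), Thm. I.7, Thm. II.3, §VII.2.
* [Langlands1976] R. P. Langlands, *On the Functional Equations Satisfied by Eisenstein Series*, LNM 544 (1976), §7.
* [Knapp1986] A. W. Knapp, *Representation Theory of Semisimple Groups* (1986), VIII §3.
* [BorelJacquet1979] A. Borel, H. Jacquet, PSPM 33.1 (1979), §4.1, §4.6.
-/

set_option autoImplicit false
-- the mandated namespace repeats the single-problem summit's segment (`HodgeConjecture.HodgeConjecture`)
set_option linter.dupNamespace false

noncomputable section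

open MeasureTheory MeasureTheory.Measure Filter Topology CompactlySupported NumberField NumberField.mixedEmbedding NumberField.InfinitePlace IsDedekindDomain Set Complex
open scoped ENNReal NNReal ComplexConjugate InnerProductSpace Real
open Literature.NumberTheory Literature.NumberTheory.Automorphic Literature.NumberTheory.Automorphic.UnitaryGroup AdelicGroupData ContRepresentation
open Literature.NumberTheory.GaloisRepresentations (HeckeCharacter)
open Literature.MeasureTheory.Group
open Summit.HodgeConjecture.HodgeConjecture.Cruxes.H413.K2E1BorelEisensteinU
open Summit.HodgeConjecture.HodgeConjecture.Cruxes.H413.K2E1BLBorelSpacesU2Defs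
open Summit.HodgeConjecture.HodgeConjecture.Cruxes.H413.K2E1BLBorelOperatorsU2Defs
open Summit.HodgeConjecture.HodgeConjecture.Cruxes.H413.K2E1CharacterEisensteinU2Defs
open Summit.HodgeConjecture.HodgeConjecture.Cruxes.H413.K2E1ChiSectionSpaceU2Defs
open Summit.HodgeConjecture.HodgeConjecture.Cruxes.H413.K2E1PlancherelIsometryOfForm (mem_topologicalClosure_span)
open Summit.HodgeConjecture.HodgeConjecture.Cruxes.H413.K2E1PlancherelModelMapOfIsometry (completeSpace_topologicalClosure_span modelMap_apply_of_mem modelMap_apply_eq_modelMap_proj)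
open Summit.HodgeConjecture.HodgeConjecture.Cruxes.H413.K2E1ChiSectionPlancherelSelfDualM1CMTwoSqrt (exists_linearIsometry_chiSection_selfDual_m1_letterFree_sqrt_cm_two)
open Summit.HodgeConjecture.HodgeConjecture.Cruxes.H413.K2E1ChiSectionPlancherelSelfDualCMTwo (finiteDimensional_span_range)
open Summit.HodgeConjecture.HodgeConjecture.Cruxes.H413.K2E1ChiSectionBoundedOfUnitaryU2 (exists_bound_of_isChiSection_of_isUnitary)
open Summit.HodgeConjecture.HodgeConjecture.Cruxes.H413.K2E1SymbolLineNoMassCMTwo (hline_restrict_of_nonconstant_symbol)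
open Summit.HodgeConjecture.HodgeConjecture.Cruxes.H413.K2E1SphericalEisensteinStructuralDataCMTwo (isInvInvariant_of_isHaarMeasure_cm_two)
open Summit.HodgeConjecture.HodgeConjecture.Cruxes.H413.K2E1SphericalEisensteinStructuralDataCMThree (exists_coveringWeight_unfoldedMeasure)
open Summit.HodgeConjecture.HodgeConjecture.Cruxes.H413.K2E1MaassSelbergCMTwoFinal (exists_unipotent_binders_cm_two)
open Summit.HodgeConjecture.HodgeConjecture.Cruxes.H413.K2E1ChiSectionArchConstantSelfDualCMTwo (hVinf_maximalLevel_of_selfDual_cm)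
open Summit.HodgeConjecture.HodgeConjecture.Cruxes.H413.K2E1ResidualBlockPackageOffDualHeckeCMTwo (exists_offDual_hecke_on_fix starProjection_apply_of_selfAdjoint_fix starProjection_congr_of_eq kAverage_apply_eq_self_of_mem_block)
open Summit.HodgeConjecture.HodgeConjecture.Cruxes.H413.K2E1ResidualBlockPackageOffDualFamilyCMTwo (eq_zero_of_isChiSection_of_forall_K)
open Summit.HodgeConjecture.HodgeConjecture.Cruxes.H413.K2E1MaximalLevelHeckePureTensorBridgeCMTwo (adelicVal_archToAdelic_inclusion_mem_standardMaximalCompactGL)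
open Summit.HodgeConjecture.HodgeConjecture.Cruxes.H413.K2E1PseudoEisensteinFamilyDecompositionU2 (pureTensor_arithmeticBorel_mul)
open Summit.HodgeConjecture.HodgeConjecture.Cruxes.H413.K2E1EisensteinNiceClassCMTwo (memLp_quotFun_eisensteinSeriesU_of_nice)
open Summit.HodgeConjecture.HodgeConjecture.Cruxes.H413.K2E1PseudoEisensteinSmoothBricksDenseU2 (exists_band_forall_smooth_approx)
open Summit.HodgeConjecture.HodgeConjecture.Cruxes.H413.K2E1ResidualBlockPackageSelfDualFamilyCMTwo

namespace Summit.HodgeConjecture.HodgeConjecture.Cruxes.H413.K2E1ResidualBlockPackageSelfDualM1CMTwo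


/-! ## §1 Three small lemmas: the `L²` class of a brick, `φ(1) = 0 ⇒ φ = 0` at `K_max`, `hline` on the axis -/

section Lemmas

variable (L : Type) [Field L] [NumberField L] [IsCMField L]
  (μ : Measure (quasiSplit (↥(maximalRealSubfield L)) L (IsCMField.complexConj L) 2).automorphicQuotient)
  [MeasurableSpace (quasiSplit (↥(maximalRealSubfield L)) L (IsCMField.complexConj L) 2).Adelic] [BorelSpace (quasiSplit (↥(maximalRealSubfield L)) L (IsCMField.complexConj L) 2).Adelic]

/-- **THE `L²` CLASS OF A BRICK `θ_{f,φ}`** (★ F3d-δ `memLp_quotFun_eisensteinSeriesU_of_nice`): `f ∈ C_c((0,∞))`, `φ ∈ V(χ, K′, 1)` continuous and bounded ⇒ `quotFun E((f∘H)·φ) ∈ L²(X)` — the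
profile is continuous (★ `continuous_borelHeight`), left-`B(F)`-invariant (★ `pureTensor_arithmeticBorel_mul`), bounded, and supported in a height band (★ `exists_band_forall_smooth_approx`).
[cite: MoeglinWaldspurger1995, II.1.2] -/
theorem memLp_brick [IsFiniteMeasure μ] {χ : HeckeCharacter L} {K' : Subgroup (quasiSplit (↥(maximalRealSubfield L)) L (IsCMField.complexConj L) 2).Adelic} {f : ℝ → ℂ} (hf : Continuous f) (hfs : HasCompactSupport f) (hf0 : tsupport f ⊆ Ioi 0)
    {φ : (quasiSplit (↥(maximalRealSubfield L)) L (IsCMField.complexConj L) 2).Adelic → ℂ} (hφV : φ ∈ chiSectionSpace χ K' 1) (hφc : Continuous φ) {Mφ : ℝ} (hφM : ∀ x, ‖φ x‖ ≤ Mφ) :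
    MemLp ((quasiSplit (↥(maximalRealSubfield L)) L (IsCMField.complexConj L) 2).quotFun (eisensteinSeriesU (fun g : (quasiSplit (↥(maximalRealSubfield L)) L (IsCMField.complexConj L) 2).Adelic => f (borelHeight g : ℝ) * φ g))) 2 μ := by
  obtain ⟨a, b, ha, hfa, -⟩ := exists_band_forall_smooth_approx hf hfs hf0
  obtain ⟨Mf, hMf⟩ := hf.bounded_above_of_compact_support hfs
  have huc : Continuous (fun g : (quasiSplit (↥(maximalRealSubfield L)) L (IsCMField.complexConj L) 2).Adelic => f (borelHeight g : ℝ) * φ g) := (hf.comp (NNReal.continuous_coe.comp continuous_borelHeight)).mul hφc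
  have huM : ∀ g : (quasiSplit (↥(maximalRealSubfield L)) L (IsCMField.complexConj L) 2).Adelic, ‖f (borelHeight g : ℝ) * φ g‖ ≤ Mf * Mφ := fun g => by
    rw [norm_mul]; exact mul_le_mul (hMf _) (hφM _) (norm_nonneg _) ((norm_nonneg _).trans (hMf 1))
  have hband : ∀ g : (quasiSplit (↥(maximalRealSubfield L)) L (IsCMField.complexConj L) 2).Adelic, f (borelHeight g : ℝ) * φ g ≠ 0 → Real.toNNReal a ≤ borelHeight g ∧ borelHeight g ≤ Real.toNNReal b := by
    intro g hg
    have hfg : f (borelHeight g : ℝ) ≠ 0 := fun h => hg (by rw [h, zero_mul])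
    obtain ⟨h1, h2⟩ := hfa _ hfg
    exact ⟨by rw [← NNReal.coe_le_coe, Real.coe_toNNReal _ ha.le]; exact h1, by rw [← NNReal.coe_le_coe, Real.coe_toNNReal _ (ha.le.trans (h1.trans h2))]; exact h2⟩
  exact memLp_quotFun_eisensteinSeriesU_of_nice L μ 2 huc (pureTensor_arithmeticBorel_mul f hφV) huM (Real.toNNReal_pos.2 ha) hband

omit [MeasurableSpace (quasiSplit (↥(maximalRealSubfield L)) L (IsCMField.complexConj L) 2).Adelic] [BorelSpace (quasiSplit (↥(maximalRealSubfield L)) L (IsCMField.complexConj L) 2).Adelic] in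
/-- At the maximal level a section vanishing at `1` vanishes identically (right `K`-invariance `φ(k) = φ(1)` and ★ `eq_zero_of_isChiSection_of_forall_K`). [cite: BorelJacquet1979, §4.1] -/
theorem eq_zero_of_apply_one_eq_zero {χ : HeckeCharacter L} {φ : (quasiSplit (↥(maximalRealSubfield L)) L (IsCMField.complexConj L) 2).Adelic → ℂ} (hφV : φ ∈ chiSectionSpace χ ((standardMaximalCompactGL 2 L).comap (adelicVal (↥(maximalRealSubfield L)) L (IsCMField.complexConj L) 2 ((StdForm.antidiagonal 2).over L)) : Subgroup (quasiSplit (↥(maximalRealSubfield L)) L (IsCMField.complexConj L) 2).Adelic) 1) (h0 : φ 1 = 0) : φ = 0 :=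
  eq_zero_of_isChiSection_of_forall_K L (isChiSection_of_mem hφV) fun k hk => by
    have h := apply_mul_of_mem hφV 1 ⟨k, Subgroup.mem_comap.2 hk⟩
    rw [one_mul, Pi.one_apply, one_mul] at h
    rw [h, h0]

/-- **`hline` ON THE AXIS MODEL `((0,∞), vol)`** for ONE entire non-constant symbol read as `t ↦ ŝ(½ + it)` (★ `hline_restrict_of_nonconstant_symbol`, `t₀ = 0`). [cite: ReedSimonI1980, §VII.2] -/
theorem hline_axis {ŝ : ℂ → ℂ} (hŝd : Differentiable ℂ ŝ) (hnc : ∃ z₁ z₂ : ℂ, ŝ z₁ ≠ ŝ z₂) :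
    ∀ c : Unit → ℂ, ((volume : Measure ℝ).restrict (Ioi 0)) {t : ℝ | ∀ j : Unit, (fun (_ : Unit) (t : ℝ) => ŝ ((((1 / 2 : ℝ)) : ℂ) + t * Complex.I)) j t = c j} = 0 := by
  intro c
  have h := hline_restrict_of_nonconstant_symbol (Ioi (0 : ℝ)) (fun _ : Unit => ŝ) () hŝd hnc 0 Set.univ c
  rw [Set.univ_inter] at h
  have hset : {t : ℝ | ∀ j : Unit, (fun (_ : Unit) (t : ℝ) => ŝ ((((1 / 2 : ℝ)) : ℂ) + t * Complex.I)) j t = c j} =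
      {y : ℝ | ∀ j : Unit, (fun _ : Unit => ŝ) j ((1 / 2 : ℂ) + ((y + 0 : ℝ) : ℂ) * Complex.I) = c j} := by
    ext t
    simp only [Set.mem_setOf_eq, add_zero]
    have e : ((((1 / 2 : ℝ)) : ℂ) + (t : ℂ) * Complex.I) = (1 / 2 : ℂ) + (t : ℂ) * Complex.I := by push_cast; ring
    rw [e]
  rw [hset]
  exact h

end Lemmas

/-! ## §2 THE PACKAGING LEMMA (model side abstract in `W`, Hilbert side `L²(μ)` for any measure): from a Plancherel isometry `U_iso : Θ ≅ (⊕_{c∈S} W) ⊕₂ L²((0,∞); W)` of the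
closed span `Θ` of a family, a block `G = Θ`, a projector identity `P_G P₁ = P_G`, the Hecke relation `T v = P₁ (R v)` on `V_P` and the model intertwining
`(U_iso P_Θ)(R v) = ((d_c • (U_iso P_Θ v)_c)_c, σ • (U_iso P_Θ v)_cont)`, TO the per-block ∃-package of ★ `rung1_of_block_packages` (family 2) — stated in ONE instance context, so that
the package's witnesses and its clauses are elaborated along the same instance paths -/

section Model

variable {X : Type*} [MeasurableSpace X] (μX : Measure X) {W : Type} [NormedAddCommGroup W] [InnerProductSpace ℂ W] [FiniteDimensional ℂ W] {ι Γ : Type*} [TopologicalSpace Γ]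

/-- **THE PACKAGING LEMMA.**  Witnesses `(A, Ω, m, E, Jb) := (⊕_{c∈S} W, ℝ, vol|_{(0,∞)}, W, Unit)`, `V := WithLp.linearEquiv ∘ U_iso ∘ P_Θ`, `h := a♮` (constant family), `s := σ`; the `hU` clause is
`T v = P₁ (R v)`, `P_G P₁ = P_G`, `U_iso P_Θ P_G = U_iso P_Θ` (★ `modelMap_apply_eq_modelMap_proj`) and the intertwining read on the continuous coordinate; `hV` is the isometry
(★ `modelMap_apply_of_mem`); `hhl`, `hhr`, `hline` are carried as the abstract predicates `HL`, `HR` and the hypothesis `hline`. [cite: ReedSimonI1980, Thm. I.7, Thm. II.3]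
[cite: MoeglinWaldspurger1995, II.2.4] -/
theorem package_of_modelMap [ENNReal.HolderTriple ∞ 2 2] (S : Finset ℝ) (x : ι → Lp ℂ 2 μX)
    (Uiso : ↥(Submodule.span ℂ (Set.range x)).topologicalClosure →ₗᵢ[ℂ] WithLp 2 (PiLp 2 (fun _ : ↥S => W) × Lp W 2 ((volume : Measure ℝ).restrict (Ioi 0))))
    (G : Submodule ℂ (Lp ℂ 2 μX)) [G.HasOrthogonalProjection] (hG : G = (Submodule.span ℂ (Set.range x)).topologicalClosure)
    (an : C_c(Γ, ℂ)) (HL HR : C_c(Γ, ℂ) → Prop) (hl : HL an) (hr : HR an)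
    (Tof : C_c(Γ, ℂ) → (Lp ℂ 2 μX →L[ℂ] Lp ℂ 2 μX)) (P : Lp ℂ 2 μX →L[ℂ] Lp ℂ 2 μX) {P₁ R : Lp ℂ 2 μX →L[ℂ] Lp ℂ 2 μX}
    (hPG : ∀ w, G.starProjection (P₁ w) = G.starProjection w)
    (hT : ∀ v ∈ LinearMap.eqLocus (P : Lp ℂ 2 μX →ₗ[ℂ] Lp ℂ 2 μX) LinearMap.id, Tof an v = P₁ (R v))
    (d : ↥S → ℂ) (σ : ℝ → ℂ) (hσ : MemLp σ ∞ ((volume : Measure ℝ).restrict (Ioi 0)))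
    (hline : ∀ c : Unit → ℂ, ((volume : Measure ℝ).restrict (Ioi 0)) {t | ∀ j : Unit, (fun _ : Unit => σ) j t = c j} = 0)
    (hmodel : ∀ v : Lp ℂ 2 μX,
      haveI := completeSpace_topologicalClosure_span x
      (Uiso.toContinuousLinearMap.comp (Submodule.span ℂ (Set.range x)).topologicalClosure.orthogonalProjectionOnto) (R v) =
        WithLp.toLp 2 (WithLp.toLp 2 (fun k : ↥S => d k • ((Uiso.toContinuousLinearMap.comp (Submodule.span ℂ (Set.range x)).topologicalClosure.orthogonalProjectionOnto) v).fst k), (hσ.toLp σ : Lp ℂ ∞ ((volume : Measure ℝ).restrict (Ioi 0))) • ((Uiso.toContinuousLinearMap.comp (Submodule.span ℂ (Set.range x)).topologicalClosure.orthogonalProjectionOnto) v).snd)) :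
    ∃ (A : Type) (_ : AddCommGroup A) (_ : Module ℂ A) (_ : FiniteDimensional ℂ A) (Ω : Type) (_ : MeasurableSpace Ω) (m : Measure Ω)
      (E : Type) (_ : NormedAddCommGroup E) (_ : NormedSpace ℂ E) (V : Lp ℂ 2 μX →ₗ[ℂ] (A × Lp E 2 m))
      (Jb : Type) (_ : Countable Jb) (h : Jb → C_c(Γ, ℂ)) (s : Jb → Ω → ℂ) (hs : ∀ j, MemLp (s j) ∞ m),
      (∀ j, HL (h j)) ∧ (∀ j, HR (h j)) ∧
      (∀ j, ∀ v ∈ LinearMap.eqLocus (P : Lp ℂ 2 μX →ₗ[ℂ] Lp ℂ 2 μX) LinearMap.id,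
        ((V ∘ₗ ((G.starProjection : Lp ℂ 2 μX →L[ℂ] Lp ℂ 2 μX)).toLinearMap) ((Tof (h j)) v)).2 =
          ((hs j).toLp (s j) • ((V ∘ₗ ((G.starProjection : Lp ℂ 2 μX →L[ℂ] Lp ℂ 2 μX)).toLinearMap) v).2 : Lp E 2 m)) ∧
      (∀ (c : Jb → ℂ), m {x | ∀ j, s j x = c j} = 0) ∧
      (∀ y ∈ G, V y = 0 → y = 0) := by
  haveI := completeSpace_topologicalClosure_span x
  subst hG
  refine ⟨PiLp 2 (fun _ : ↥S => W), inferInstance, inferInstance, inferInstance, ℝ, inferInstance, ((volume : Measure ℝ).restrict (Ioi 0)), W, inferInstance, inferInstance,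
    (WithLp.linearEquiv 2 ℂ (PiLp 2 (fun _ : ↥S => W) × Lp W 2 ((volume : Measure ℝ).restrict (Ioi 0)))).toLinearMap ∘ₗ (Uiso.toContinuousLinearMap.comp (Submodule.span ℂ (Set.range x)).topologicalClosure.orthogonalProjectionOnto).toLinearMap,
    Unit, inferInstance, fun _ => an, fun _ => σ, fun _ => hσ, fun _ => hl, fun _ => hr, fun _ v hv => ?_, hline, fun z hz h0 => ?_⟩
  · -- `hU`: `T v = P₁ (R v)`, `P_G P₁ = P_G`, `U_iso P_Θ P_G = U_iso P_Θ`, then the intertwining on the continuous coordinate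
    have hsp : ∀ w, (Uiso.toContinuousLinearMap.comp (Submodule.span ℂ (Set.range x)).topologicalClosure.orthogonalProjectionOnto) ((Submodule.span ℂ (Set.range x)).topologicalClosure.starProjection w) = (Uiso.toContinuousLinearMap.comp (Submodule.span ℂ (Set.range x)).topologicalClosure.orthogonalProjectionOnto) w := fun w => by
      rw [Submodule.starProjection_apply]
      exact (modelMap_apply_eq_modelMap_proj x Uiso w).symm
    change (WithLp.ofLp ((Uiso.toContinuousLinearMap.comp (Submodule.span ℂ (Set.range x)).topologicalClosure.orthogonalProjectionOnto) ((Submodule.span ℂ (Set.range x)).topologicalClosure.starProjection (Tof an v)))).2 =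
      (hσ.toLp σ : Lp ℂ ∞ ((volume : Measure ℝ).restrict (Ioi 0))) • (WithLp.ofLp ((Uiso.toContinuousLinearMap.comp (Submodule.span ℂ (Set.range x)).topologicalClosure.orthogonalProjectionOnto) ((Submodule.span ℂ (Set.range x)).topologicalClosure.starProjection v))).2
    rw [hT v hv, hPG, hsp, hsp, hmodel v]
    rfl
  · -- `hV`: `U_iso` is an isometry on `Θ`
    have h0' : (WithLp.linearEquiv 2 ℂ (PiLp 2 (fun _ : ↥S => W) × Lp W 2 ((volume : Measure ℝ).restrict (Ioi 0)))) ((Uiso.toContinuousLinearMap.comp (Submodule.span ℂ (Set.range x)).topologicalClosure.orthogonalProjectionOnto) z) = 0 := h0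
    have h2 : (Uiso.toContinuousLinearMap.comp (Submodule.span ℂ (Set.range x)).topologicalClosure.orthogonalProjectionOnto) z = 0 := (WithLp.linearEquiv 2 ℂ (PiLp 2 (fun _ : ↥S => W) × Lp W 2 ((volume : Measure ℝ).restrict (Ioi 0)))).map_eq_zero_iff.1 h0'
    rw [modelMap_apply_of_mem x Uiso ⟨z, hz⟩] at h2
    have hn : ‖(⟨z, hz⟩ : ↥(Submodule.span ℂ (Set.range x)).topologicalClosure)‖ = 0 := by rw [← Uiso.norm_map, h2, norm_zero]
    exact congrArg Subtype.val (norm_eq_zero.1 hn)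

end Model

/-! ## §3 HEAD: the SELF-DUAL per-block package in the FINAL's ∃-shape

The head takes ALL its binders explicitly (no section `variable`s): with section variables in scope Lean's `unusedSectionVars` check runs `Expr.containsFVar` once per
variable over the (heavily shared) proof term, which here costs > 10 minutes of wall time for no heartbeats; with explicit binders the file elaborates in well under a minute. -/

-- heartbeat-scoped as ★ p861599 FILE B (400k; ★ p861419 `offDual_block_package` runs at 1.6M): ELABORATION ONLY — nested existential eliminations of ★ heads (★ p861360 §3 has
-- 15 clauses, ★ FILE 1a head 11) against the ~3 kB goal type; no search tactic, no `decide`, no `simp` normal form; the whole file elaborates in < 30 s on the farm.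
set_option maxHeartbeats 400000 in
/-- **THE SELF-DUAL PER-BLOCK PACKAGE OF ★ p861518 §2 (RUNG 1), IN THE FINAL'S EXISTENTIAL SHAPE (the `hSD` binder of ★ `residual_invariants_finiteDimensional_maximalLevel_cm_final`).**
Frame: `G = U(J₂)` over `L∕L⁺`, `K_∞ = G(L⁺ ⊗ ℝ) ∩ U(1 ⊗ 1)` with `κ` the inclusion and the TRIVIAL `K_∞`-type `χ₁ ≡ 1`, a finite level `K′_f = U₀ ∩ G(𝔸_f)` (`U₀ ≤ GL₂(𝔸_L^∞)` open compact,
`ι_f(K′_f) ⊆ K`; M1: `U₀ = GL₂(𝒪̂_L)`, ★ `m1_level_witness`) with its normalised idempotent `e`, the block projector `P = P_1 ∘L R_f(e)`, the section level `K` itself (maximal), a Haar measure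
`μKU` of `K` (the model measure), and a SELF-DUAL UNITARY Hecke character `χ` trivial on `ℝ_{>0}` with `V(χ, K, 1) ≠ ⊥` and continuous sections (`hVc`).  For every generating set `gen` whose
closed span is the closed span of the C⁰-bricks of `χ` at `K` (C7″'s block), the per-block ∃-package of ★ `rung1_of_block_packages` (family 2, atoms `FiniteDimensional`) holds, witnessed by
`(A, Ω, m, E, Jb) := (⊕_{c∈S} W, ℝ, vol|_{(0,∞)}, W, Unit)`, `W = span{1•φ|_K} ≤ L²(K, μKU)`: **`V`** `= WithLp.linearEquiv ∘ U_iso ∘ P_Θ` (★ p861360 on the `C²_c`-profile family — its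
archimedean letter is ★ p861808 — and FILE B §1 identifies its closed span with the block), **`h` SPHERICAL** (★ FILE 1a), **`s = ŝ(½+i·)`**, **`hU` on `V_P`** (★ FILE 1a `T v = P_1 R(η) v`,
`P_G P_1 = P_G`, FILE B §3 on all of `L²`), **`hline`** (§1), **`hV`** (`U_iso` isometric on `Θ ⊇ G`); the structural measures (`ν_G = (ν_∞ ⊗ ν_f)_*`, idelic and radical data with
`ν 𝓕 = 1`, covering weight, unfolded measure) are inhabited inside, as in ★ p861419. [cite: MoeglinWaldspurger1995, II.2.4, IV.1.10, IV.3.12, VI.2] [cite: ReedSimonI1980, Thm. I.7, Thm. II.3]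
[cite: Langlands1976, §7] [cite: Knapp1986, VIII §3] [cite: CasselsFrohlichANT1967, Ch. XV Thm. 4.1.3] -/
theorem selfDual_block_package
    (L : Type) [Field L] [NumberField L] [IsCMField L]
    (μ : Measure (quasiSplit (↥(maximalRealSubfield L)) L (IsCMField.complexConj L) 2).automorphicQuotient)
    [MeasurableSpace (quasiSplit (↥(maximalRealSubfield L)) L (IsCMField.complexConj L) 2).Adelic] [BorelSpace (quasiSplit (↥(maximalRealSubfield L)) L (IsCMField.complexConj L) 2).Adelic]
    [(quasiSplit (↥(maximalRealSubfield L)) L (IsCMField.complexConj L) 2).IsAutomorphicMeasure μ]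
    [MeasurableSpace (UnitaryGroup.arch (↥(maximalRealSubfield L)) L (IsCMField.complexConj L) 2 ((StdForm.antidiagonal 2).over L))] [BorelSpace (UnitaryGroup.arch (↥(maximalRealSubfield L)) L (IsCMField.complexConj L) 2 ((StdForm.antidiagonal 2).over L))]
    [MeasurableSpace (finAdelic (↥(maximalRealSubfield L)) L (IsCMField.complexConj L) 2 ((StdForm.antidiagonal 2).over L))] [BorelSpace (finAdelic (↥(maximalRealSubfield L)) L (IsCMField.complexConj L) 2 ((StdForm.antidiagonal 2).over L))]
    (νinf : Measure (UnitaryGroup.arch (↥(maximalRealSubfield L)) L (IsCMField.complexConj L) 2 ((StdForm.antidiagonal 2).over L))) [IsHaarMeasure νinf] [νinf.IsInvInvariant] [SFinite νinf]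
    (νf : Measure (finAdelic (↥(maximalRealSubfield L)) L (IsCMField.complexConj L) 2 ((StdForm.antidiagonal 2).over L))) [IsFiniteMeasureOnCompacts νf] [νf.IsMulLeftInvariant] [νf.IsOpenPosMeasure]
    [MeasurableSpace ↥(UnitaryGroup.arch (↥(maximalRealSubfield L)) L (IsCMField.complexConj L) 2 ((StdForm.antidiagonal 2).over L) ⊓ unitaryGroupOfForm (conjMixed (↥(maximalRealSubfield L)) L (IsCMField.complexConj L)) 1)] [BorelSpace ↥(UnitaryGroup.arch (↥(maximalRealSubfield L)) L (IsCMField.complexConj L) 2 ((StdForm.antidiagonal 2).over L) ⊓ unitaryGroupOfForm (conjMixed (↥(maximalRealSubfield L)) L (IsCMField.complexConj L)) 1)]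
    (μK : Measure ↥(UnitaryGroup.arch (↥(maximalRealSubfield L)) L (IsCMField.complexConj L) 2 ((StdForm.antidiagonal 2).over L) ⊓ unitaryGroupOfForm (conjMixed (↥(maximalRealSubfield L)) L (IsCMField.complexConj L)) 1)) [IsProbabilityMeasure μK] [μK.IsMulLeftInvariant] [μK.IsMulRightInvariant] [μK.IsInvInvariant]
    (χ₁ : C_c(↥(UnitaryGroup.arch (↥(maximalRealSubfield L)) L (IsCMField.complexConj L) 2 ((StdForm.antidiagonal 2).over L) ⊓ unitaryGroupOfForm (conjMixed (↥(maximalRealSubfield L)) L (IsCMField.complexConj L)) 1), ℂ)) (e : C_c(finAdelic (↥(maximalRealSubfield L)) L (IsCMField.complexConj L) 2 ((StdForm.antidiagonal 2).over L), ℂ))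
    [MeasurableMul (finAdelic (↥(maximalRealSubfield L)) L (IsCMField.complexConj L) 2 ((StdForm.antidiagonal 2).over L))] [ENNReal.HolderTriple ∞ 2 2] (hχ1 : ∀ k, χ₁ k = 1)
    (K' : Subgroup (finAdelic (↥(maximalRealSubfield L)) L (IsCMField.complexConj L) 2 ((StdForm.antidiagonal 2).over L))) (hK'o : IsOpen (K' : Set (finAdelic (↥(maximalRealSubfield L)) L (IsCMField.complexConj L) 2 ((StdForm.antidiagonal 2).over L))))
    (he0 : ∀ x, x ∉ K' → e x = 0) (he1 : ∫ x, e x ∂νf = 1) (heK : ∀ k ∈ K', ∀ x, e (k * x) = e x)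
    (P : (quasiSplit (↥(maximalRealSubfield L)) L (IsCMField.complexConj L) 2).L2 μ →L[ℂ] (quasiSplit (↥(maximalRealSubfield L)) L (IsCMField.complexConj L) 2).L2 μ) (hPdef : P = ((((quasiSplit (↥(maximalRealSubfield L)) L (IsCMField.complexConj L) 2).rightRegular μ).restrict ((archToAdelic (↥(maximalRealSubfield L)) L (IsCMField.complexConj L) 2 ((StdForm.antidiagonal 2).over L)).comp (Subgroup.inclusion (inf_le_left : UnitaryGroup.arch (↥(maximalRealSubfield L)) L (IsCMField.complexConj L) 2 ((StdForm.antidiagonal 2).over L) ⊓ unitaryGroupOfForm (conjMixed (↥(maximalRealSubfield L)) L (IsCMField.complexConj L)) 1 ≤ UnitaryGroup.arch (↥(maximalRealSubfield L)) L (IsCMField.complexConj L) 2 ((StdForm.antidiagonal 2).over L))))).integratedOperator (((quasiSplit (↥(maximalRealSubfield L)) L (IsCMField.complexConj L) 2).isUnitary_rightRegular μ).restrict _) (((quasiSplit (↥(maximalRealSubfield L)) L (IsCMField.complexConj L) 2).isStronglyContinuous_rightRegular_holds μ).restrict _ ((continuous_archToAdelic (↥(maximalRealSubfield L)) L (IsCMField.complexConj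 L) 2 ((StdForm.antidiagonal 2).over L)).comp (continuous_induced_rng.2 continuous_subtype_val))) μK χ₁) ∘L ((((quasiSplit (↥(maximalRealSubfield L)) L (IsCMField.complexConj L) 2).rightRegular μ).restrict (finAdelicToAdelic (↥(maximalRealSubfield L)) L (IsCMField.complexConj L) 2 ((StdForm.antidiagonal 2).over L))).integratedOperator (((quasiSplit (↥(maximalRealSubfield L)) L (IsCMField.complexConj L) 2).isUnitary_rightRegular μ).restrict _) (((quasiSplit (↥(maximalRealSubfield L)) L (IsCMField.complexConj L) 2).isStronglyContinuous_rightRegular_holds μ).restrict _ (continuous_finAdelicToAdelic (↥(maximalRealSubfield L)) L (IsCMField.complexConj L) 2 ((StdForm.antidiagonal 2).over L))) νf e))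
    (U₀ : Subgroup (GL (Fin 2) (FiniteAdeleRing (𝓞 L) L))) (hU₀o : IsOpen (U₀ : Set (GL (Fin 2) (FiniteAdeleRing (𝓞 L) L)))) (hU₀c : IsCompact (U₀ : Set (GL (Fin 2) (FiniteAdeleRing (𝓞 L) L))))
    (hK'U₀ : ∀ b : finAdelic (↥(maximalRealSubfield L)) L (IsCMField.complexConj L) 2 ((StdForm.antidiagonal 2).over L), b ∈ K' ↔ (b : GL (Fin 2) (FiniteAdeleRing (𝓞 L) L)) ∈ U₀)
    (hU₀Kc : ∀ b : finAdelic (↥(maximalRealSubfield L)) L (IsCMField.complexConj L) 2 ((StdForm.antidiagonal 2).over L), (b : GL (Fin 2) (FiniteAdeleRing (𝓞 L) L)) ∈ U₀ → (finAdelicToAdelic (↥(maximalRealSubfield L)) L (IsCMField.complexConj L) 2 ((StdForm.antidiagonal 2).over L)) b ∈ ((standardMaximalCompactGL 2 L).comap (adelicVal (↥(maximalRealSubfield L)) L (IsCMField.complexConj L) 2 ((StdForm.antidiagonal 2).over L)) : Subgroup (quasiSplit (↥(maximalRealSubfield L)) L (IsCMField.complexConj L) 2).Adelic))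
    -- the model measure: a Haar measure of the compact `K` (the FINAL feeds `haar`)
    (μKU : Measure ↥((standardMaximalCompactGL 2 L).comap (adelicVal (↥(maximalRealSubfield L)) L (IsCMField.complexConj L) 2 ((StdForm.antidiagonal 2).over L)) : Subgroup (quasiSplit (↥(maximalRealSubfield L)) L (IsCMField.complexConj L) 2).Adelic)) [μKU.IsHaarMeasure]
    -- the self-dual block
    {χ : HeckeCharacter L} (hχu : χ.IsUnitary) (hρ : ∀ r : ℝ≥0ˣ, χ (posRealIdele L r) = 1) (hsd : reflectChar (IsCMField.complexConj L) χ = χ)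
    (hne : chiSectionSpace χ ((standardMaximalCompactGL 2 L).comap (adelicVal (↥(maximalRealSubfield L)) L (IsCMField.complexConj L) 2 ((StdForm.antidiagonal 2).over L)) : Subgroup (quasiSplit (↥(maximalRealSubfield L)) L (IsCMField.complexConj L) 2).Adelic) 1 ≠ ⊥)
    (hVc : ∀ φ ∈ chiSectionSpace χ ((standardMaximalCompactGL 2 L).comap (adelicVal (↥(maximalRealSubfield L)) L (IsCMField.complexConj L) 2 ((StdForm.antidiagonal 2).over L)) : Subgroup (quasiSplit (↥(maximalRealSubfield L)) L (IsCMField.complexConj L) 2).Adelic) 1, Continuous φ)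
    (gen : Set ((quasiSplit (↥(maximalRealSubfield L)) L (IsCMField.complexConj L) 2).L2 μ)) (hgen : (Submodule.span ℂ gen).topologicalClosure = (Submodule.span ℂ {v : (quasiSplit (↥(maximalRealSubfield L)) L (IsCMField.complexConj L) 2).L2 μ |
        ∃ (f : ℝ → ℂ) (_ : Continuous f) (_ : HasCompactSupport f) (_ : tsupport f ⊆ Ioi 0)
          (φ' : (quasiSplit (↥(maximalRealSubfield L)) L (IsCMField.complexConj L) 2).Adelic → ℂ) (_ : φ' ∈ chiSectionSpace χ ((standardMaximalCompactGL 2 L).comap (adelicVal (↥(maximalRealSubfield L)) L (IsCMField.complexConj L) 2 ((StdForm.antidiagonal 2).over L)) : Subgroup (quasiSplit (↥(maximalRealSubfield L)) L (IsCMField.complexConj L) 2).Adelic) 1) (_ : Continuous φ')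
          (hv : MemLp ((quasiSplit (↥(maximalRealSubfield L)) L (IsCMField.complexConj L) 2).quotFun (eisensteinSeriesU (fun g => f (borelHeight g) * φ' g))) 2 μ), v = hv.toLp _}).topologicalClosure) :
    ∃ (A : Type) (_ : AddCommGroup A) (_ : Module ℂ A) (_ : FiniteDimensional ℂ A) (Ω : Type) (_ : MeasurableSpace Ω) (m : Measure Ω)
      (E : Type) (_ : NormedAddCommGroup E) (_ : NormedSpace ℂ E) (V : (quasiSplit (↥(maximalRealSubfield L)) L (IsCMField.complexConj L) 2).L2 μ →ₗ[ℂ] (A × Lp E 2 m))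
      (Jb : Type) (_ : Countable Jb) (h : Jb → C_c(UnitaryGroup.arch (↥(maximalRealSubfield L)) L (IsCMField.complexConj L) 2 ((StdForm.antidiagonal 2).over L), ℂ)) (s : Jb → Ω → ℂ) (hs : ∀ j, MemLp (s j) ∞ m),
      (∀ (j : Jb) (k : ↥(UnitaryGroup.arch (↥(maximalRealSubfield L)) L (IsCMField.complexConj L) 2 ((StdForm.antidiagonal 2).over L) ⊓ unitaryGroupOfForm (conjMixed (↥(maximalRealSubfield L)) L (IsCMField.complexConj L)) 1)) (x : UnitaryGroup.arch (↥(maximalRealSubfield L)) L (IsCMField.complexConj L) 2 ((StdForm.antidiagonal 2).over L)), h j ((Subgroup.inclusion (inf_le_left : UnitaryGroup.arch (↥(maximalRealSubfield L)) L (IsCMField.complexConj L) 2 ((StdForm.antidiagonal 2).over L) ⊓ unitaryGroupOfForm (conjMixed (↥(maximalRealSubfield L)) L (IsCMField.complexConj L)) 1 ≤ UnitaryGroup.arch (↥(maximalRealSubfield L)) L (IsCMField.complexConj L) 2 ((StdForm.antidiagonal 2).over L))) k * x) = χ₁ k * h j x) ∧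
      (∀ (j : Jb) (k : ↥(UnitaryGroup.arch (↥(maximalRealSubfield L)) L (IsCMField.complexConj L) 2 ((StdForm.antidiagonal 2).over L) ⊓ unitaryGroupOfForm (conjMixed (↥(maximalRealSubfield L)) L (IsCMField.complexConj L)) 1)) (x : UnitaryGroup.arch (↥(maximalRealSubfield L)) L (IsCMField.complexConj L) 2 ((StdForm.antidiagonal 2).over L)), h j (x * (Subgroup.inclusion (inf_le_left : UnitaryGroup.arch (↥(maximalRealSubfield L)) L (IsCMField.complexConj L) 2 ((StdForm.antidiagonal 2).over L) ⊓ unitaryGroupOfForm (conjMixed (↥(maximalRealSubfield L)) L (IsCMField.complexConj L)) 1 ≤ UnitaryGroup.arch (↥(maximalRealSubfield L)) L (IsCMField.complexConj L) 2 ((StdForm.antidiagonal 2).over L))) k) = χ₁ k * h j x) ∧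
      (∀ j, ∀ v ∈ LinearMap.eqLocus (P : (quasiSplit (↥(maximalRealSubfield L)) L (IsCMField.complexConj L) 2).L2 μ →ₗ[ℂ] (quasiSplit (↥(maximalRealSubfield L)) L (IsCMField.complexConj L) 2).L2 μ) LinearMap.id,
    ((V ∘ₗ (((Submodule.span ℂ gen).topologicalClosure).starProjection : (quasiSplit (↥(maximalRealSubfield L)) L (IsCMField.complexConj L) 2).L2 μ →L[ℂ] (quasiSplit (↥(maximalRealSubfield L)) L (IsCMField.complexConj L) 2).L2 μ).toLinearMap) (((((quasiSplit (↥(maximalRealSubfield L)) L (IsCMField.complexConj L) 2).rightRegular μ).restrict (archToAdelic (↥(maximalRealSubfield L)) L (IsCMField.complexConj L) 2 ((StdForm.antidiagonal 2).over L))).integratedOperator (((quasiSplit (↥(maximalRealSubfield L)) L (IsCMField.complexConj L) 2).isUnitary_rightRegular μ).restrict _) (((quasiSplit (↥(maximalRealSubfield L)) L (IsCMField.complexConj L) 2).isStronglyContinuous_rightRegular_holds μ).restrict _ (continuous_archToAdelic (↥(maximalRealSubfield L)) L (IsCMField.complexConj L) 2 ((StdForm.antidiagonal 2).over L))) νinf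 (h j) ∘L (((quasiSplit (↥(maximalRealSubfield L)) L (IsCMField.complexConj L) 2).rightRegular μ).restrict (finAdelicToAdelic (↥(maximalRealSubfield L)) L (IsCMField.complexConj L) 2 ((StdForm.antidiagonal 2).over L))).integratedOperator (((quasiSplit (↥(maximalRealSubfield L)) L (IsCMField.complexConj L) 2).isUnitary_rightRegular μ).restrict _) (((quasiSplit (↥(maximalRealSubfield L)) L (IsCMField.complexConj L) 2).isStronglyContinuous_rightRegular_holds μ).restrict _ (continuous_finAdelicToAdelic (↥(maximalRealSubfield L)) L (IsCMField.complexConj L) 2 ((StdForm.antidiagonal 2).over L))) νf e) v)).2 = ((hs j).toLp (s j) • ((V ∘ₗ (((Submodule.span ℂ gen).topologicalClosure).starProjection : (quasiSplit (↥(maximalRealSubfield L)) L (IsCMField.complexConj L) 2).L2 μ →L[ℂ] (quasiSplit (↥(maximalRealSubfield L)) L (IsCMField.complexConj L) 2).L2 μ).toLinearMap) v).2 : Lp E 2 m)) ∧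
      (∀ (c : Jb → ℂ), m {x | ∀ j, s j x = c j} = 0) ∧
      (∀ y ∈ (Submodule.span ℂ gen).topologicalClosure, V y = 0 → y = 0) := by
  classical
  -- instances: the adelic group is locally compact second countable; `ν_f` Haar; `K` compact so `μ_K` finite
  haveI := t2Space_adeleRing_of_numberField L
  haveI := locallyCompactSpace_adeleRing' L
  haveI := secondCountableTopology_adeleRing L
  haveI : LocallyCompactSpace (quasiSplit (↥(maximalRealSubfield L)) L (IsCMField.complexConj L) 2).Adelic := inferInstanceAs (LocallyCompactSpace (adelic (↥(maximalRealSubfield L)) L (IsCMField.complexConj L) 2 ((StdForm.antidiagonal 2).over L)))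
  haveI : SecondCountableTopology (quasiSplit (↥(maximalRealSubfield L)) L (IsCMField.complexConj L) 2).Adelic := inferInstanceAs (SecondCountableTopology (adelic (↥(maximalRealSubfield L)) L (IsCMField.complexConj L) 2 ((StdForm.antidiagonal 2).over L)))
  haveI : IsHaarMeasure νf := { toIsFiniteMeasureOnCompacts := inferInstance, toIsMulLeftInvariant := inferInstance, toIsOpenPosMeasure := inferInstance }
  haveI : SFinite νf := sFinite_haar_finAdelic (↥(maximalRealSubfield L)) L (IsCMField.complexConj L) 2 ((StdForm.antidiagonal 2).over L) νf
  -- `ν_G = (ν_∞ ⊗ ν_f)_*` is a Haar measure of `G(𝔸)` (★ `adelicProdEquiv`), inversion-invariant (unimodular, ★), s-finite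
  let ψ := (adelicProdEquiv (↥(maximalRealSubfield L)) L (IsCMField.complexConj L) 2 ((StdForm.antidiagonal 2).over L)).symm
  have hψ : (fun q : (UnitaryGroup.arch (↥(maximalRealSubfield L)) L (IsCMField.complexConj L) 2 ((StdForm.antidiagonal 2).over L)) × (finAdelic (↥(maximalRealSubfield L)) L (IsCMField.complexConj L) 2 ((StdForm.antidiagonal 2).over L)) => archToAdelic (↥(maximalRealSubfield L)) L (IsCMField.complexConj L) 2 ((StdForm.antidiagonal 2).over L) q.1 * finAdelicToAdelic (↥(maximalRealSubfield L)) L (IsCMField.complexConj L) 2 ((StdForm.antidiagonal 2).over L) q.2) = ⇑ψ := rfl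
  obtain ⟨νG, hνG⟩ : ∃ νG : Measure (quasiSplit (↥(maximalRealSubfield L)) L (IsCMField.complexConj L) 2).Adelic, νG = (νinf.prod νf).map (fun q : (UnitaryGroup.arch (↥(maximalRealSubfield L)) L (IsCMField.complexConj L) 2 ((StdForm.antidiagonal 2).over L)) × (finAdelic (↥(maximalRealSubfield L)) L (IsCMField.complexConj L) 2 ((StdForm.antidiagonal 2).over L)) => archToAdelic (↥(maximalRealSubfield L)) L (IsCMField.complexConj L) 2 ((StdForm.antidiagonal 2).over L) q.1 * finAdelicToAdelic (↥(maximalRealSubfield L)) L (IsCMField.complexConj L) 2 ((StdForm.antidiagonal 2).over L) q.2) := ⟨_, rfl⟩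
  haveI : νG.IsHaarMeasure := by rw [hνG, hψ]; exact ψ.isHaarMeasure_map _
  haveI : νG.IsInvInvariant := isInvInvariant_of_isHaarMeasure_cm_two L νG
  haveI : SFinite νG := by rw [hνG]; infer_instance
  have hKc : IsCompact ((((standardMaximalCompactGL 2 L).comap (adelicVal (↥(maximalRealSubfield L)) L (IsCMField.complexConj L) 2 ((StdForm.antidiagonal 2).over L)) : Subgroup (quasiSplit (↥(maximalRealSubfield L)) L (IsCMField.complexConj L) 2).Adelic)) : Set (quasiSplit (↥(maximalRealSubfield L)) L (IsCMField.complexConj L) 2).Adelic) := isCompact_comap_adelicVal_standardMaximalCompactGL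
  haveI : CompactSpace ↥((standardMaximalCompactGL 2 L).comap (adelicVal (↥(maximalRealSubfield L)) L (IsCMField.complexConj L) 2 ((StdForm.antidiagonal 2).over L)) : Subgroup (quasiSplit (↥(maximalRealSubfield L)) L (IsCMField.complexConj L) 2).Adelic) := isCompact_iff_compactSpace.1 hKc
  haveI : IsFiniteMeasure μKU := CompactSpace.isFiniteMeasure
  -- ★ FILE 1a: the Hecke operator (`η`, `ŝ`, spherical `a♮`) with `T v = P_1 (R(η) v)` on `V_P`, at `K_c := K`
  -- (existentials are eliminated with `Exists.elim`, never `obtain`: the goal is ~4 kB and a dependent `cases` motive over it is what costs the heartbeats)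
  refine (exists_offDual_hecke_on_fix L μ νinf νf νG μK χ₁ e hχ1 hνG K' hK'o he0 he1 heK U₀ hU₀o hU₀c hK'U₀ (Kc := ((standardMaximalCompactGL 2 L).comap (adelicVal (↥(maximalRealSubfield L)) L (IsCMField.complexConj L) 2 ((StdForm.antidiagonal 2).over L)) : Subgroup (quasiSplit (↥(maximalRealSubfield L)) L (IsCMField.complexConj L) 2).Adelic)) le_rfl (fun _ hk => Subgroup.mem_comap.2 hk) hU₀Kc hVc).elim
    fun η h => h.elim fun ŝ h => h.elim fun an h => ?_
  have hηsymm := h.1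
  have hηreal := h.2.1
  have hŝd := h.2.2.1
  have hnc := h.2.2.2.1
  have hact := h.2.2.2.2.1
  have hanl := h.2.2.2.2.2.1
  have hanr := h.2.2.2.2.2.2.1
  have hfix := h.2.2.2.2.2.2.2
  clear h
  -- the normalised section `φ` of the rank-one block: `φ(1) = 1`
  refine ((Submodule.ne_bot_iff _).1 hne).elim fun φ₀ h => ?_
  have hφ₀V := h.1
  have hφ₀ne := h.2
  clear h
  have hφ₀1 : φ₀ 1 ≠ 0 := fun h0 => hφ₀ne (eq_zero_of_apply_one_eq_zero L hφ₀V h0)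
  refine (⟨_, rfl⟩ : ∃ φ : (quasiSplit (↥(maximalRealSubfield L)) L (IsCMField.complexConj L) 2).Adelic → ℂ, φ = (φ₀ 1)⁻¹ • φ₀).elim fun φ hφdef => ?_
  have hφV : φ ∈ chiSectionSpace χ ((standardMaximalCompactGL 2 L).comap (adelicVal (↥(maximalRealSubfield L)) L (IsCMField.complexConj L) 2 ((StdForm.antidiagonal 2).over L)) : Subgroup (quasiSplit (↥(maximalRealSubfield L)) L (IsCMField.complexConj L) 2).Adelic) (fun _ => 1) := hφdef ▸ Submodule.smul_mem _ _ hφ₀V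
  have hφc : Continuous φ := hVc φ hφV
  have hφ1 : φ 1 = 1 := by rw [hφdef, Pi.smul_apply, smul_eq_mul, inv_mul_cancel₀ hφ₀1]
  have hφ1ne : φ 1 ≠ 0 := by rw [hφ1]; exact one_ne_zero
  have hφ1r : conj (φ 1) = φ 1 := by rw [hφ1, map_one]
  have hφinf : ∀ a : arch (↥(maximalRealSubfield L)) L (IsCMField.complexConj L) 2 ((StdForm.antidiagonal 2).over L), φ (archToAdelic (↥(maximalRealSubfield L)) L (IsCMField.complexConj L) 2 _ a) = φ 1 :=
    hVinf_maximalLevel_of_selfDual_cm L hsd φ hφV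
  refine (exists_bound_of_isChiSection_of_isUnitary L 2 hχu (isChiSection_of_mem hφV) hφc).elim fun Mφ hφM => ?_
  have hφ1V : ((1 : ℂ) • φ) ∈ chiSectionSpace χ ((standardMaximalCompactGL 2 L).comap (adelicVal (↥(maximalRealSubfield L)) L (IsCMField.complexConj L) 2 ((StdForm.antidiagonal 2).over L)) : Subgroup (quasiSplit (↥(maximalRealSubfield L)) L (IsCMField.complexConj L) 2).Adelic) 1 := Submodule.smul_mem _ _ hφV
  have hφ1c : Continuous ((1 : ℂ) • φ) := hφc.const_smul _
  have hφ1M : ∀ x, ‖((1 : ℂ) • φ) x‖ ≤ Mφ := fun x => by rw [Pi.smul_apply, one_smul]; exact hφM x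
  -- the `L²(K)`-class of `1 • φ|_K` and the `C²_c`-profile family of bricks
  have hvm : MemLp (fun k : ↥((standardMaximalCompactGL 2 L).comap (adelicVal (↥(maximalRealSubfield L)) L (IsCMField.complexConj L) 2 ((StdForm.antidiagonal 2).over L)) : Subgroup (quasiSplit (↥(maximalRealSubfield L)) L (IsCMField.complexConj L) 2).Adelic) => ((fun _ : Unit => (1 : ℂ)) () • φ) (k : (quasiSplit (↥(maximalRealSubfield L)) L (IsCMField.complexConj L) 2).Adelic)) 2 μKU :=
    MemLp.of_bound (hφ1c.comp continuous_subtype_val).aestronglyMeasurable Mφ (Eventually.of_forall fun _ => hφ1M _)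
  refine (⟨_, rfl⟩ : ∃ Idx : Set (ℝ → ℂ), Idx = {f : ℝ → ℂ | ContDiff ℝ 2 f ∧ HasCompactSupport f ∧ tsupport f ⊆ Ioi 0}).elim fun Idx hI => ?_
  have hmem : ∀ i : ↥Idx, (i : ℝ → ℂ) ∈ {f : ℝ → ℂ | ContDiff ℝ 2 f ∧ HasCompactSupport f ∧ tsupport f ⊆ Ioi 0} := fun i => hI ▸ i.2
  have hy : ∀ i : ↥Idx, MemLp ((quasiSplit (↥(maximalRealSubfield L)) L (IsCMField.complexConj L) 2).quotFun (eisensteinSeriesU (fun g : (quasiSplit (↥(maximalRealSubfield L)) L (IsCMField.complexConj L) 2).Adelic => (i : ℝ → ℂ) (borelHeight g : ℝ) * ((fun _ : Unit => (1 : ℂ) • φ) ()) g))) 2 μ :=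
    fun i => memLp_brick L μ (hmem i).1.continuous (hmem i).2.1 (hmem i).2.2 hφ1V hφ1c hφ1M
  -- opaque names for the `L²(K)`-vector and the family (keeps every later type small and syntactically uniform)
  refine (⟨fun _ => hvm.toLp _, fun _ => hvm.coeFn_toLp⟩ : ∃ vK : Unit → Lp ℂ 2 μKU, ∀ a : Unit, ((vK a : Lp ℂ 2 μKU) : ↥((standardMaximalCompactGL 2 L).comap (adelicVal (↥(maximalRealSubfield L)) L (IsCMField.complexConj L) 2 ((StdForm.antidiagonal 2).over L)) : Subgroup (quasiSplit (↥(maximalRealSubfield L)) L (IsCMField.complexConj L) 2).Adelic) → ℂ) =ᵐ[μKU]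
      fun k => ((fun _ : Unit => (1 : ℂ)) a • φ) (k : (quasiSplit (↥(maximalRealSubfield L)) L (IsCMField.complexConj L) 2).Adelic)).elim fun vK hvK => ?_
  refine (⟨fun i _ => (hy i).toLp _, fun i _ => (hy i).coeFn_toLp⟩ : ∃ y : ↥Idx → Unit → Lp ℂ 2 μ, ∀ (i : ↥Idx) (a : Unit), ((y i a : Lp ℂ 2 μ) : (quasiSplit (↥(maximalRealSubfield L)) L (IsCMField.complexConj L) 2).automorphicQuotient → ℂ) =ᵐ[μ]
      (quasiSplit (↥(maximalRealSubfield L)) L (IsCMField.complexConj L) 2).quotFun (eisensteinSeriesU (fun g : (quasiSplit (↥(maximalRealSubfield L)) L (IsCMField.complexConj L) 2).Adelic => (i : ℝ → ℂ) (borelHeight g : ℝ) * ((fun _ : Unit => (1 : ℂ) • φ) a) g))).elim fun y hyae => ?_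
  -- the idelic data (Borel σ-algebra and a Haar measure of `𝔸_Lˣ`, an idele class domain), the radical data `(ν, 𝓕)` with `ν 𝓕 = 1` (★ `exists_unipotent_binders_cm_two`; `N(𝔸) ≅ 𝔸_L⁻` is
  -- abelian, so `ν` is right-invariant ★), and the covering weight with the unfolded measure of `ν_G` (★ every-rank `exists_coveringWeight_unfoldedMeasure`)
  letI : MeasurableSpace (AdeleRing (𝓞 L) L)ˣ := borel _
  haveI : BorelSpace (AdeleRing (𝓞 L) L)ˣ := ⟨rfl⟩
  obtain ⟨_hI1, _hI2, _hI3⟩ := locallyCompactSpace_secondCountable_t2_idele (E := L)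
  obtain ⟨⟨_𝓕I, h𝓕I⟩, ν, _hν, _hνinv, _𝓕, h𝓕N, h𝓕1, h𝓕c⟩ := exists_unipotent_binders_cm_two L
  haveI : ν.IsMulRightInvariant := isMulRightInvariant_of_isMulLeftInvariant_two ν
  obtain ⟨_β, _μZ, hβ, _hsf, hμZ⟩ := exists_coveringWeight_unfoldedMeasure νG
  -- ★ p861360: the letter-free rank-one SD isometry with residue coordinate (`α := Unit`, `c := 1`, `σ₀ := 2`)
  refine (exists_linearIsometry_chiSection_selfDual_m1_letterFree_sqrt_cm_two L μ νG μKU (haar : Measure (AdeleRing (𝓞 L) L)ˣ) h𝓕I ν h𝓕N h𝓕1 h𝓕c hβ hμZ hχu hρ hsd hφV hφc hφM hφinf hφ1ne hφ1r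
      (ι := ↥Idx) (fun _ : Unit => (1 : ℂ)) (fun _ => one_ne_zero) vK hvK
      (f := fun (i : ↥Idx) (_ : Unit) => (i : ℝ → ℂ)) (fun i _ => (hmem i).1) (fun i _ => (hmem i).2.1) (fun i _ => (hmem i).2.2)
      y hyae (σ₀ := 2) (by norm_num)).elim
    fun sc h => h.elim fun _Psc h => h.elim fun _C h => h.elim fun S h => h.elim fun _ρ h => h.elim fun T h => h.elim fun r' h => h.elim fun w h => h.elim fun Uiso h => ?_
  have hr_apply := h.2.2.2.2.2.2.2.2.2.2.2.1
  have hw := h.2.2.2.2.2.2.2.2.2.2.2.2.2.1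
  have hU := h.2.2.2.2.2.2.2.2.2.2.2.2.2.2
  clear h
  haveI : FiniteDimensional ℂ ↥(Submodule.span ℂ (Set.range vK)) := finiteDimensional_span_range _
  -- FILE B §3: `R(η)Θ ⊆ Θ` and `U R(η) = (diag ŝ(c) ⊕ M_σ) U` on all of `L²`
  refine (exists_selfDual_modelMap_intertwining L μ νG μKU (haar : Measure (AdeleRing (𝓞 L) L)ˣ) h𝓕I ν h𝓕N h𝓕1 h𝓕c hβ hμZ hχu hρ hsd hφV hφc hφM hφinf hφ1ne hφ1r η hηsymm hηreal hŝd hact hI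
    y hyae (fun a : Unit => (⟨vK a, Submodule.subset_span ⟨a, rfl⟩⟩ : ↥(Submodule.span ℂ (Set.range vK))))
    sc S T r' w Uiso hr_apply hw hU).elim fun hσ h => ?_
  have hmodel := h.2
  clear h
  haveI : CompleteSpace ↥(Submodule.span ℂ gen).topologicalClosure := (Submodule.isClosed_topologicalClosure _).completeSpace_coe
  -- FILE B §1: the block IS the closed span of the family
  have hGΘ : (Submodule.span ℂ gen).topologicalClosure = (Submodule.span ℂ (Set.range fun i : ↥Idx => ∑ a, y i a)).topologicalClosure :=
    hgen.trans (topologicalClosure_span_bricks_eq_selfDual L μ hχu hφV hφc hφ1ne hI y hyae)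
  -- `P_1` is self-adjoint and fixes the block ⇒ `P_G ∘ P_1 = P_G`; the model map factors through `P_G`
  have hKinfK : ∀ k : ↥(UnitaryGroup.arch (↥(maximalRealSubfield L)) L (IsCMField.complexConj L) 2 ((StdForm.antidiagonal 2).over L) ⊓ unitaryGroupOfForm (conjMixed (↥(maximalRealSubfield L)) L (IsCMField.complexConj L)) 1), (archToAdelic (↥(maximalRealSubfield L)) L (IsCMField.complexConj L) 2 ((StdForm.antidiagonal 2).over L)) ((Subgroup.inclusion (inf_le_left : UnitaryGroup.arch (↥(maximalRealSubfield L)) L (IsCMField.complexConj L) 2 ((StdForm.antidiagonal 2).over L) ⊓ unitaryGroupOfForm (conjMixed (↥(maximalRealSubfield L)) L (IsCMField.complexConj L)) 1 ≤ UnitaryGroup.arch (↥(maximalRealSubfield L)) L (IsCMField.complexConj L) 2 ((StdForm.antidiagonal 2).over L))) k) ∈ ((standardMaximalCompactGL 2 L).comap (adelicVal (↥(maximalRealSubfield L)) L (IsCMField.complexConj L) 2 ((StdForm.antidiagonal 2).over L)) : Subgroup (quasiSplit (↥(maximalRealSubfield L)) L (IsCMField.complexConj L) 2).Adelic) := fun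 k => Subgroup.mem_comap.2 (adelicVal_archToAdelic_inclusion_mem_standardMaximalCompactGL k)
  have hadj₁ : ContinuousLinearMap.adjoint ((((quasiSplit (↥(maximalRealSubfield L)) L (IsCMField.complexConj L) 2).rightRegular μ).restrict ((archToAdelic (↥(maximalRealSubfield L)) L (IsCMField.complexConj L) 2 ((StdForm.antidiagonal 2).over L)).comp (Subgroup.inclusion (inf_le_left : UnitaryGroup.arch (↥(maximalRealSubfield L)) L (IsCMField.complexConj L) 2 ((StdForm.antidiagonal 2).over L) ⊓ unitaryGroupOfForm (conjMixed (↥(maximalRealSubfield L)) L (IsCMField.complexConj L)) 1 ≤ UnitaryGroup.arch (↥(maximalRealSubfield L)) L (IsCMField.complexConj L) 2 ((StdForm.antidiagonal 2).over L))))).integratedOperator (((quasiSplit (↥(maximalRealSubfield L)) L (IsCMField.complexConj L) 2).isUnitary_rightRegular μ).restrict _) (((quasiSplit (↥(maximalRealSubfield L)) L (IsCMField.complexConj L) 2).isStronglyContinuous_rightRegular_holds μ).restrict _ ((continuous_archToAdelic (↥(maximalRealSubfield L)) L (IsCMField.complexConj L) 2 ((StdForm.antidiagonal 2).over L)).comp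 (continuous_induced_rng.2 continuous_subtype_val))) μK χ₁) = ((((quasiSplit (↥(maximalRealSubfield L)) L (IsCMField.complexConj L) 2).rightRegular μ).restrict ((archToAdelic (↥(maximalRealSubfield L)) L (IsCMField.complexConj L) 2 ((StdForm.antidiagonal 2).over L)).comp (Subgroup.inclusion (inf_le_left : UnitaryGroup.arch (↥(maximalRealSubfield L)) L (IsCMField.complexConj L) 2 ((StdForm.antidiagonal 2).over L) ⊓ unitaryGroupOfForm (conjMixed (↥(maximalRealSubfield L)) L (IsCMField.complexConj L)) 1 ≤ UnitaryGroup.arch (↥(maximalRealSubfield L)) L (IsCMField.complexConj L) 2 ((StdForm.antidiagonal 2).over L))))).integratedOperator (((quasiSplit (↥(maximalRealSubfield L)) L (IsCMField.complexConj L) 2).isUnitary_rightRegular μ).restrict _) (((quasiSplit (↥(maximalRealSubfield L)) L (IsCMField.complexConj L) 2).isStronglyContinuous_rightRegular_holds μ).restrict _ ((continuous_archToAdelic (↥(maximalRealSubfield L)) L (IsCMField.complexConj L) 2 ((StdForm.antidiagonal 2).over L)).comp (continuous_induced_rng.2 continuous_subtype_val))) μK χ₁) :=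
    K2E1KTypeProjectorPureTensorU.adjoint_kType ((quasiSplit (↥(maximalRealSubfield L)) L (IsCMField.complexConj L) 2).rightRegular μ) ((quasiSplit (↥(maximalRealSubfield L)) L (IsCMField.complexConj L) 2).isUnitary_rightRegular μ) ((quasiSplit (↥(maximalRealSubfield L)) L (IsCMField.complexConj L) 2).isStronglyContinuous_rightRegular_holds μ) (archToAdelic (↥(maximalRealSubfield L)) L (IsCMField.complexConj L) 2 ((StdForm.antidiagonal 2).over L)) (continuous_archToAdelic (↥(maximalRealSubfield L)) L (IsCMField.complexConj L) 2 ((StdForm.antidiagonal 2).over L)) (Subgroup.inclusion (inf_le_left : UnitaryGroup.arch (↥(maximalRealSubfield L)) L (IsCMField.complexConj L) 2 ((StdForm.antidiagonal 2).over L) ⊓ unitaryGroupOfForm (conjMixed (↥(maximalRealSubfield L)) L (IsCMField.complexConj L)) 1 ≤ UnitaryGroup.arch (↥(maximalRealSubfield L)) L (IsCMField.complexConj L) 2 ((StdForm.antidiagonal 2).over L))) (continuous_induced_rng.2 continuous_subtype_val) μK χ₁ fun _ => by rw [hχ1, hχ1, map_one]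
  have hfixG : ∀ t ∈ (Submodule.span ℂ gen).topologicalClosure, ((((quasiSplit (↥(maximalRealSubfield L)) L (IsCMField.complexConj L) 2).rightRegular μ).restrict ((archToAdelic (↥(maximalRealSubfield L)) L (IsCMField.complexConj L) 2 ((StdForm.antidiagonal 2).over L)).comp (Subgroup.inclusion (inf_le_left : UnitaryGroup.arch (↥(maximalRealSubfield L)) L (IsCMField.complexConj L) 2 ((StdForm.antidiagonal 2).over L) ⊓ unitaryGroupOfForm (conjMixed (↥(maximalRealSubfield L)) L (IsCMField.complexConj L)) 1 ≤ UnitaryGroup.arch (↥(maximalRealSubfield L)) L (IsCMField.complexConj L) 2 ((StdForm.antidiagonal 2).over L))))).integratedOperator (((quasiSplit (↥(maximalRealSubfield L)) L (IsCMField.complexConj L) 2).isUnitary_rightRegular μ).restrict _) (((quasiSplit (↥(maximalRealSubfield L)) L (IsCMField.complexConj L) 2).isStronglyContinuous_rightRegular_holds μ).restrict _ ((continuous_archToAdelic (↥(maximalRealSubfield L)) L (IsCMField.complexConj L) 2 ((StdForm.antidiagonal 2).over L)).comp (continuous_induced_rng.2 continuous_subtype_val))) μK χ₁) t = t := fun t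 ht =>
    kAverage_apply_eq_self_of_mem_block L μ μK χ₁ hχ1 (Kc := ((standardMaximalCompactGL 2 L).comap (adelicVal (↥(maximalRealSubfield L)) L (IsCMField.complexConj L) 2 ((StdForm.antidiagonal 2).over L)) : Subgroup (quasiSplit (↥(maximalRealSubfield L)) L (IsCMField.complexConj L) 2).Adelic)) le_rfl hKinfK t (hgen ▸ ht)
  have hPG : ∀ w', (Submodule.span ℂ gen).topologicalClosure.starProjection (((((quasiSplit (↥(maximalRealSubfield L)) L (IsCMField.complexConj L) 2).rightRegular μ).restrict ((archToAdelic (↥(maximalRealSubfield L)) L (IsCMField.complexConj L) 2 ((StdForm.antidiagonal 2).over L)).comp (Subgroup.inclusion (inf_le_left : UnitaryGroup.arch (↥(maximalRealSubfield L)) L (IsCMField.complexConj L) 2 ((StdForm.antidiagonal 2).over L) ⊓ unitaryGroupOfForm (conjMixed (↥(maximalRealSubfield L)) L (IsCMField.complexConj L)) 1 ≤ UnitaryGroup.arch (↥(maximalRealSubfield L)) L (IsCMField.complexConj L) 2 ((StdForm.antidiagonal 2).over L))))).integratedOperator (((quasiSplit (↥(maximalRealSubfield L)) L (IsCMField.complexConj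 L) 2).isUnitary_rightRegular μ).restrict _) (((quasiSplit (↥(maximalRealSubfield L)) L (IsCMField.complexConj L) 2).isStronglyContinuous_rightRegular_holds μ).restrict _ ((continuous_archToAdelic (↥(maximalRealSubfield L)) L (IsCMField.complexConj L) 2 ((StdForm.antidiagonal 2).over L)).comp (continuous_induced_rng.2 continuous_subtype_val))) μK χ₁) w') = (Submodule.span ℂ gen).topologicalClosure.starProjection w' :=
    starProjection_apply_of_selfAdjoint_fix (Submodule.span ℂ gen).topologicalClosure _ hadj₁ hfixG
  -- the package (§2 `package_of_modelMap`): `(A, Ω, m, E, Jb) := (⊕_{c∈S} W, ℝ, vol|_{(0,∞)}, W, Unit)`, `V = linearEquiv ∘ U_iso ∘ P_Θ`, `h = a♮`, `s = ŝ(½ + i·)`; the `hU` clause from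
  -- `T v = P_1 R(η) v` (★ FILE 1a), `P_G P_1 = P_G`, `U_iso P_Θ P_G = U_iso P_Θ` and FILE B §3's intertwining; `hline` §1; `hV` the isometry
  exact package_of_modelMap μ S (fun i : ↥Idx => ∑ a, y i a) Uiso (Submodule.span ℂ gen).topologicalClosure hGΘ an
    (fun a => ∀ (k : ↥(UnitaryGroup.arch (↥(maximalRealSubfield L)) L (IsCMField.complexConj L) 2 ((StdForm.antidiagonal 2).over L) ⊓ unitaryGroupOfForm (conjMixed (↥(maximalRealSubfield L)) L (IsCMField.complexConj L)) 1)) (x : UnitaryGroup.arch (↥(maximalRealSubfield L)) L (IsCMField.complexConj L) 2 ((StdForm.antidiagonal 2).over L)), a ((Subgroup.inclusion (inf_le_left : UnitaryGroup.arch (↥(maximalRealSubfield L)) L (IsCMField.complexConj L) 2 ((StdForm.antidiagonal 2).over L) ⊓ unitaryGroupOfForm (conjMixed (↥(maximalRealSubfield L)) L (IsCMField.complexConj L)) 1 ≤ UnitaryGroup.arch (↥(maximalRealSubfield L)) L (IsCMField.complexConj L) 2 ((StdForm.antidiagonal 2).over L))) k * x) = χ₁ k * a x)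
    (fun a => ∀ (k : ↥(UnitaryGroup.arch (↥(maximalRealSubfield L)) L (IsCMField.complexConj L) 2 ((StdForm.antidiagonal 2).over L) ⊓ unitaryGroupOfForm (conjMixed (↥(maximalRealSubfield L)) L (IsCMField.complexConj L)) 1)) (x : UnitaryGroup.arch (↥(maximalRealSubfield L)) L (IsCMField.complexConj L) 2 ((StdForm.antidiagonal 2).over L)), a (x * (Subgroup.inclusion (inf_le_left : UnitaryGroup.arch (↥(maximalRealSubfield L)) L (IsCMField.complexConj L) 2 ((StdForm.antidiagonal 2).over L) ⊓ unitaryGroupOfForm (conjMixed (↥(maximalRealSubfield L)) L (IsCMField.complexConj L)) 1 ≤ UnitaryGroup.arch (↥(maximalRealSubfield L)) L (IsCMField.complexConj L) 2 ((StdForm.antidiagonal 2).over L))) k) = χ₁ k * a x)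
    hanl hanr
    (fun a => ((((quasiSplit (↥(maximalRealSubfield L)) L (IsCMField.complexConj L) 2).rightRegular μ).restrict (archToAdelic (↥(maximalRealSubfield L)) L (IsCMField.complexConj L) 2 ((StdForm.antidiagonal 2).over L))).integratedOperator (((quasiSplit (↥(maximalRealSubfield L)) L (IsCMField.complexConj L) 2).isUnitary_rightRegular μ).restrict _) (((quasiSplit (↥(maximalRealSubfield L)) L (IsCMField.complexConj L) 2).isStronglyContinuous_rightRegular_holds μ).restrict _ (continuous_archToAdelic (↥(maximalRealSubfield L)) L (IsCMField.complexConj L) 2 ((StdForm.antidiagonal 2).over L))) νinf a ∘L (((quasiSplit (↥(maximalRealSubfield L)) L (IsCMField.complexConj L) 2).rightRegular μ).restrict (finAdelicToAdelic (↥(maximalRealSubfield L)) L (IsCMField.complexConj L) 2 ((StdForm.antidiagonal 2).over L))).integratedOperator (((quasiSplit (↥(maximalRealSubfield L)) L (IsCMField.complexConj L) 2).isUnitary_rightRegular μ).restrict _) (((quasiSplit (↥(maximalRealSubfield L)) L (IsCMField.complexConj L) 2).isStronglyContinuous_rightRegular_holds μ).restrict _ (continuous_finAdelicToAdelic (↥(maximalRealSubfield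 L)) L (IsCMField.complexConj L) 2 ((StdForm.antidiagonal 2).over L))) νf e))
    P hPG (fun v hv => hfix v (hPdef ▸ hv)) (fun k : ↥S => ŝ ((k : ℝ) : ℂ)) (fun t : ℝ => ŝ ((((1 / 2 : ℝ)) : ℂ) + t * Complex.I)) hσ (hline_axis hŝd hnc) hmodel

end Summit.HodgeConjecture.HodgeConjecture.Cruxes.H413.K2E1ResidualBlockPackageSelfDualM1CMTwo

end
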